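/-
Origin: expansion seat `prover-pub-hodgecm-mc-binder-1-g12-0`, handover #62 2026-08-20T12:32:23Z md5 7de09e15f552 (NEW additive KERNEL leaf; imports #61 + HypCensus/ArchDatumBlockCM; drop-alone) (`HOME/mc/pub-hodgecm-mc-binder-1-g12/stage51/HodgeCM/Model/Binders/Real34IsoScaleFrame.lean`, md5 7de09e15f552, 67 lines);
landed by the gen-20 packager (p-g20) in gate run 51 as `HodgeCM/Model/Binders/Real34IsoScaleFrame.lean` (verbatim).
-/
/-
Origin: pub-hodgecm MODEL-CONSTRUCTION sub-cell (Hodge conjecture, CM-per-L package), seat mc-binder-1 gen 12, session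
prover-pub-hodgecm-mc-binder-1-g12-0, 2026-08-20.  Target in PKG: HodgeCM/Model/Binders/Real34IsoScaleFrame.lean (NEW additive leaf; imports RUN-50 #61
`Binders/Real34IsoScaleSqrt` + binder-2's `HypCensus/ArchDatumBlockCM`).  KERNEL MATHEMATICS ONLY.  Consumer: `harch` of the row-17 socket, HARCH-PLAN.md §5 (2)/§7:
the canonical `W`-scalings `cmDW` of the census pin `diag(dW)` and of the see-saw pin `diag(dW')` are related by binder-2's monomial isometry data place by place.
-/
import Summits.HodgeConjecture.HodgeCM.Model.Binders.Real34IsoScaleSqrt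
import Summits.HodgeConjecture.HodgeCM.Model.HypCensus.ArchDatumBlockCM

/-!
# Row 17 (`real34`): the census `W`-scalings after the monomial substitution are the see-saw pin's `W`-scalings

At a real place `v` of `L⁺` let `w := cmPlaceOver L v` be the chosen complex place of the CM field `L` over `v`.  For two conjugation-fixed diagonals
`dW, dW' : Fin 2 → L` (the census pin `diag(a₀,a₁)` and the see-saw pin `diag(a₂,a₃)`), binder-2's place data (#52 `HypCensus/IsoTwist`): `placeRe L d w j =
Re σ_w(d j)`, `σ_w = placePerm L dW dW' w`, scales `isoScale (placeRe L dW w) (placeRe L dW' w) j = √(Re σ_w(dW' j) / Re σ_w(dW (σ_w j)))`; and the canonical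
scaled-frame weights `cmDW L dV d hd ι₁ v j = √|Re σ_w(d j) / c_W(v)|` (`HypCensus/ArchDatumBlockCM`, `cmXW = placeSignVec (cmRealVec d) (cmCW)`).  This file proves

* `cmXW_eq_placeRe_div`: `cmXW L dV d hd ι₁ v j = placeRe L d (cmPlaceOver L v) j / cmCW L dV ι₁ v`;
* **`cmDW_placePerm_mul_isoScale`**: `cmDW L dV dW hdW ι₁ v (σ_w j) · isoScale (placeRe L dW w) (placeRe L dW' w) j = cmDW L dV dW' hdW' ι₁ v j`
  whenever the ratios are positive (binder-2's `placeRatio_pos`, i.e. for the isometry `g : diag(dW') ⥲ diag(dW)` of record) — index by index, the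
  `monoScale` of #59 applied to `pairScale 3 2 cmDV (cmDW dW)` with the `isoMat` data IS `pairScale 3 2 cmDV (cmDW dW')` (HARCH-PLAN §5 (2), §7).

## References
* [Folland1989] G. B. Folland, *Harmonic Analysis in Phase Space*, Princeton UP (1989), §4.2.
-/

set_option autoImplicit false

noncomputable section

open NumberField NumberField.InfinitePlace
open Literature.NumberTheory.Weil1964 Literature.NumberTheory.Automorphic

namespace HodgeCM.Model.HypCensus

variable (L : Type) [Field L] [NumberField L] [IsCMField L] {N M : ℕ}
variable (dV : Fin N → L) (ι₁ : L →+* ℂ)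

/-- The canonical `W`-sign vector through binder-2's `placeRe` at the chosen complex place over `v`:
`cmXW v j = Re σ_w(d j) / c_W(v)`, `w = cmPlaceOver L v`. [folklore] -/
theorem cmXW_eq_placeRe_div (d : Fin 2 → L) (hd : ∀ i, IsCMField.complexConj L (d i) = d i)
    (v : {v : InfinitePlace ↥(maximalRealSubfield L) // v.IsReal}) (j : Fin 2) :
    cmXW L dV d hd ι₁ v j = placeRe L d (cmPlaceOver L v).1 j / cmCW L dV ι₁ v := by
  rw [cmXW, placeSignVec_cmRealVec L v (cmPlaceOver L v).1.embedding
    (by rw [InfinitePlace.mk_embedding]; exact cmPlaceOver_comap L v) d hd]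
  rfl

/-- The canonical `W`-scaling through `placeRe`: `cmDW v j = √|Re σ_w(d j) / c_W(v)|`. [folklore] -/
theorem cmDW_eq_sqrt_placeRe_div (d : Fin 2 → L) (hd : ∀ i, IsCMField.complexConj L (d i) = d i)
    (v : {v : InfinitePlace ↥(maximalRealSubfield L) // v.IsReal}) (j : Fin 2) :
    cmDW L dV d hd ι₁ v j = Real.sqrt |placeRe L d (cmPlaceOver L v).1 j / cmCW L dV ι₁ v| := by
  rw [cmDW, sqrtAbs, cmXW_eq_placeRe_div]

/-- **The census `W`-scalings after the monomial substitution are the see-saw pin's `W`-scalings**: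
`cmDW(dW) v (σ_w j) · isoScale_w j = cmDW(dW') v j` (`w = cmPlaceOver L v`, `σ_w = placePerm L dW dW' w`), given positive ratios. [folklore] -/
theorem cmDW_placePerm_mul_isoScale (dW dW' : Fin 2 → L) (hdW : ∀ i, IsCMField.complexConj L (dW i) = dW i)
    (hdW' : ∀ i, IsCMField.complexConj L (dW' i) = dW' i) (v : {v : InfinitePlace ↥(maximalRealSubfield L) // v.IsReal})
    (hr : ∀ i, 0 < placeRe L dW' (cmPlaceOver L v).1 i / placeRe L dW (cmPlaceOver L v).1 (placePerm L dW dW' (cmPlaceOver L v).1 i))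
    (j : Fin 2) :
    cmDW L dV dW hdW ι₁ v (placePerm L dW dW' (cmPlaceOver L v).1 j) *
        isoScale (placeRe L dW (cmPlaceOver L v).1) (placeRe L dW' (cmPlaceOver L v).1) j =
      cmDW L dV dW' hdW' ι₁ v j := by
  rw [cmDW_eq_sqrt_placeRe_div, cmDW_eq_sqrt_placeRe_div, sqrt_abs_div_mul_isoScale hr]

end HodgeCM.Model.HypCensus

end
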